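import Literature.MathematicalPhysics.QuantumFieldTheory.Balaban1983to89.B6RandomWalkL2
import Literature.MathematicalPhysics.QuantumFieldTheory.Balaban1983to89.B6Ineq2140KLevelV1
import Literature.MathematicalPhysics.QuantumFieldTheory.Balaban1983to89.B6OpTransposeV1

/-!
# `Balaban1983to89.B6RandomWalkL2Schur` — T. Bałaban, *Propagators and renormalization transformations for lattice gauge theories. II*,
# Commun. Math. Phys. **96** (1984) 223–250 [Balaban1984PropagatorsII], (2.134)–(2.135) p. 247 and (2.141) p. 247 IN THE `L²` NORMS OF (2.140):
# a SUP majorant of an operator AND of its transpose give its BLOCK-`ℓ²` majorant (the Schur test on one block pair) — how the `K`-legs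
# `K_{□,□′}G_{□′}h_{□′}` of the walk (2.141), i.e. `R` of (2.135), enter the `L²` summation of `…B6RandomWalkL2Chain`

statement-level skeleton of published theorems with citation tags; proofs where landed; nothing here is a claim about the Yang–Mills mass gap

WHAT IS PRINTED (p. 247 [PDF 25], render `inprint/lit-balaban-p05/renders/cmp96/p25.png`): *"|(K_{□,□′}G_{□′}h_{□′}J)(x)| ≤ O(M⁻¹)e^{−½δ₂d(y,y′)}|J| (2.134)
for x ∈ Δ(y), supp J ⊂ Δ(y′), and this together with (2.91) implies |(RJ)(x)| ≤ O(M⁻¹)e^{−½δ₂d(y,y′)}|J|, x ∈ Δ(y), supp J ⊂ Δ(y′). (2.135) Reasoning in the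
same way as in the proof of Proposition 2.2 we obtain Proposition 2.6. … ‖ζGJ‖, …, ‖ζG∇*∇*J‖ ≤ O(1)[…]|ζ|e^{−δ₃d(y,y′)}‖J‖ (2.140) … (2.141) and the series
above is convergent in the norms appearing in the inequalities (2.136)–(2.140)."*

CITATION HEADER (lean-in-tree rule) — WHAT IS REPRODUCED.  Phase-2 file of the `lit-balaban` typed skeleton (HOME `run/shared/lean/pub/lit-balaban/`), seat
**p22 gen 29** (free-target protocol G.5-34(d), TAKING HOME/STATUS 2026-08-24T13:26Z, cc r03); SKELETON row **B6.Prop2.6** × B6.Eq2.135 × B6.Eq2.141 (cells only;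
decls of record untouched).  For the `L²` summation of (2.141) (`…B6RandomWalkL2Chain.prop26_chain_2140`) the operator `R` of (2.135) must carry a BLOCK-`ℓ²`
majorant `θe^{−½δ₂d}`; print gives (2.135) in the sup shape, and the cell has it at k levels in that shape for `R` AND for its transpose (p38's
`…B6Ineq2134Transpose*`).  THIS FILE is the one-line passage between the two shapes — p22 gen 23's Schur test on one block pair
`…B6Ineq2140KLevelV1.sum_sq_cut_apply_le_of_hasMajorant_pair` BY NAME, repackaged for `…B6RandomWalkL2.HasL2Majorant`:
* **`hasL2Majorant_of_hasMajorant_pair`** — if `T` has the sup majorant `K ≥ 0` and a transpose-partner `T′` (`T′δ_x(x′) = Tδ_{x′}(x)`) the sup majorant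
  `K′ ≥ 0`, then `T` has the block-`ℓ²` majorant `(K(y,y′)K′(y′,y))^{1/2}` (geometric mean of a row bound and a column bound);
* `hasL2Majorant_of_hasMajorant_symm` (symmetric kernel: one majorant suffices), **`hasL2Majorant_of_hasMajorant_pair_le`** (both kernels dominated by ONE
  kernel `K₀` which is symmetric in `(y,y′)` — e.g. `θe^{−½δ₂d(y,y′)}` of (2.135), `d` symmetric — give the block-`ℓ²` majorant `K₀` itself: the `R`-input
  of `prop26_chain_2140` in the printed form);
* **`hasL2Majorant_transpose`** — UNLIKE the sup shape, the block-`ℓ²` shape passes to the transpose for free: `T` has the block-`ℓ²` majorant `K ≥ 0` ⟹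
  its transpose-partner `T′` has `K(y′,y)` (duality `‖Δ(y′)T′Δ(y)‖ = ‖Δ(y)TΔ(y′)‖`, by Cauchy–Schwarz) — whence the sixth entry `‖ζG∇*∇*J‖` of (2.140)
  is the fifth `‖ζ∇∇GJ‖` transposed (`G† = G`) and the third the second, once those are known in the block-`ℓ²` shape (`sum_mul_le_l2n_mul_l2n` is the
  Cauchy–Schwarz step).
THEOREMS ONLY (no definition, no `def … : Prop`, no new hypothesis); IMPORTS BY NAME, restating nothing; standard axioms.

HONEST SCOPE / DIVERGENCES.  (1) Finite-dimensional bookkeeping (Schur test); no operator of the paper appears; which operators of the k-level V1 torus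
satisfy the hypotheses (R and Rᵀ of (2.91) at k levels) is the business of the member/transposition files, not asserted here.  (2) Unweighted `ℓ²` sums on
both sides.  (3) Toward the unowned census slots (2.140)₄₋₆ (the `L²` legs of `G₀` need the member bounds (1.114), NOT this device — the two-derivative
members have no sup majorant).  NOT summit progress.  Unit `lit-balaban-p22` (gen 29), 2026-08-24.
-/

noncomputable section

open scoped BigOperators
open Finset

namespace Literature.MathematicalPhysics.QuantumFieldTheory.Balaban1983to89.B6RandomWalkL2Schur

open B6RandomWalk (HasMajorant blockPiece)
open B6RandomWalkKernel (apply_eq_sum_single)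
open B6RandomWalkL2 (l2n l2n_nonneg l2n_sq HasL2Majorant hasL2Majorant_mono)
open B6Ineq2140KLevelV1 (sum_sq_cut_apply_le_of_hasMajorant_pair)

variable {g : B6.Geometry} [DecidableEq g.Site] {X : Type} [Fintype X] [DecidableEq X]

omit [Fintype X] [DecidableEq X] in
/-- the piece `Δ(y)v` IS the cut-off of `v` by the indicator of `Δ(y)`, which is supported in `Δ(y)` and bounded by `1`.
[cite: Balaban1984PropagatorsII, (2.52) p.232 (bookkeeping, ours)] -/
theorem blockPiece_eq_indicator_mul (blk : X → g.Site) (y : g.Site) (v : X → ℝ) :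
    blockPiece blk y v = fun x => (if blk x = y then (1 : ℝ) else 0) * v x := by
  funext x
  by_cases hx : blk x = y <;> simp [blockPiece, hx]

/-- **A SUP MAJORANT OF `T` AND OF ITS TRANSPOSE GIVE THE BLOCK-`ℓ²` MAJORANT** (Schur test on the block pair `Δ(y) × Δ(y′)`): if
`|(Tμ)(x)| ≤ K(y,y′)|μ|` and `|(T′μ)(x)| ≤ K′(y,y′)|μ|` (x ∈ Δ(y), supp μ ⊂ Δ(y′)) with `K, K′ ≥ 0` and `T′δ_x(x′) = Tδ_{x′}(x)`, then
`‖Δ(y)·TJ‖ ≤ (K(y,y′)K′(y′,y))^{1/2}‖J‖` for `supp J ⊂ Δ(y′)` — the passage from the sup shape (2.135)/(2.136) to the `L²` shape (2.140).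
[cite: Balaban1984PropagatorsII, (2.135) + (2.140)–(2.141) p.247; derivation ours (Schur test), via B6Ineq2140KLevelV1] -/
theorem hasL2Majorant_of_hasMajorant_pair (blk : X → g.Site) {T T' : Module.End ℝ (X → ℝ)} {K K' : g.Site → g.Site → ℝ}
    (hT : HasMajorant blk T K) (hT' : HasMajorant blk T' K') (hK : ∀ y y', 0 ≤ K y y') (hK' : ∀ y y', 0 ≤ K' y y')
    (htr : ∀ x x', T' (Pi.single x 1) x' = T (Pi.single x' 1) x) :
    HasL2Majorant blk T (fun y y' => Real.sqrt (K y y' * K' y' y)) := by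
  intro y y' u hu
  have hζ : ∀ x, blk x ≠ y → (if blk x = y then (1 : ℝ) else 0) = 0 := fun x hx => by simp [hx]
  have hζs : ∀ x, |(if blk x = y then (1 : ℝ) else 0)| ≤ 1 := fun x => by
    by_cases hx : blk x = y <;> simp [hx]
  have hS := sum_sq_cut_apply_le_of_hasMajorant_pair blk hT hT' hK hK' htr y y' (fun x => if blk x = y then (1 : ℝ) else 0) u hζ hζs hu
  have hsq : l2n (blockPiece blk y (T u)) ^ 2 ≤ (Real.sqrt (K y y' * K' y' y) * l2n u) ^ 2 := by
    rw [l2n_sq, mul_pow, Real.sq_sqrt (mul_nonneg (hK y y') (hK' y' y)), l2n_sq, blockPiece_eq_indicator_mul]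
    simpa using hS
  have h0 : 0 ≤ Real.sqrt (K y y' * K' y' y) * l2n u := mul_nonneg (Real.sqrt_nonneg _) (l2n_nonneg u)
  have := Real.sqrt_le_sqrt hsq
  rwa [Real.sqrt_sq (l2n_nonneg _), Real.sqrt_sq h0] at this

/-- **THE SYMMETRIC CASE**: one sup majorant `K ≥ 0` of an operator with symmetric kernel (`Tδ_x(x′) = Tδ_{x′}(x)` — e.g. `G† = G`) gives the block-`ℓ²`
majorant `(K(y,y′)K(y′,y))^{1/2}`. [cite: Balaban1984PropagatorsII, (2.140)–(2.141) p.247; derivation ours (Schur test)] -/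
theorem hasL2Majorant_of_hasMajorant_symm (blk : X → g.Site) {T : Module.End ℝ (X → ℝ)} {K : g.Site → g.Site → ℝ}
    (hT : HasMajorant blk T K) (hK : ∀ y y', 0 ≤ K y y') (hsymm : ∀ x x', T (Pi.single x 1) x' = T (Pi.single x' 1) x) :
    HasL2Majorant blk T (fun y y' => Real.sqrt (K y y' * K y' y)) :=
  hasL2Majorant_of_hasMajorant_pair blk hT hT hK hK hsymm

/-- **THE PRINTED SHAPE FOR `R`**: if the sup majorants of `T` and of its transpose-partner are both dominated by ONE kernel `K₀` symmetric in `(y, y′)` —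
the (2.135) kernel `θe^{−½δ₂d(y,y′)}`, `d` symmetric — then `T` has the block-`ℓ²` majorant `K₀` itself (`(K₀(y,y′)K₀(y′,y))^{1/2} = K₀(y,y′)`): the `R`-input
of `…B6RandomWalkL2Chain.prop26_chain_2140`. [cite: Balaban1984PropagatorsII, (2.135), (2.141) p.247; derivation ours] -/
theorem hasL2Majorant_of_hasMajorant_pair_le (blk : X → g.Site) {T T' : Module.End ℝ (X → ℝ)} {K K' K₀ : g.Site → g.Site → ℝ}
    (hT : HasMajorant blk T K) (hT' : HasMajorant blk T' K') (hK : ∀ y y', 0 ≤ K y y') (hK' : ∀ y y', 0 ≤ K' y y')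
    (htr : ∀ x x', T' (Pi.single x 1) x' = T (Pi.single x' 1) x)
    (hKle : ∀ y y', K y y' ≤ K₀ y y') (hK'le : ∀ y y', K' y y' ≤ K₀ y y') (hK₀symm : ∀ y y', K₀ y y' = K₀ y' y) :
    HasL2Majorant blk T K₀ := by
  refine hasL2Majorant_mono blk (hasL2Majorant_of_hasMajorant_pair blk hT hT' hK hK' htr) fun a b => ?_
  have ha : 0 ≤ K₀ a b := (hK a b).trans (hKle a b)
  calc Real.sqrt (K a b * K' b a) ≤ Real.sqrt (K₀ a b * K₀ a b) :=
        Real.sqrt_le_sqrt (mul_le_mul (hKle a b) ((hK'le b a).trans_eq (hK₀symm b a)) (hK' b a) ha)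
    _ = K₀ a b := by rw [Real.sqrt_mul_self ha]

/-- the exponential kernel `θe^{−δd(y,y′)}` of (2.135) is symmetric when `d` is ((2.46): `d(y,y′)` is symmetric by construction), so an operator whose sup
majorant AND whose transpose's sup majorant are `θe^{−δd}` has the block-`ℓ²` majorant `θe^{−δd}`. [cite: Balaban1984PropagatorsII, (2.135) p.247 with (2.46) p.231] -/
theorem hasL2Majorant_exp_of_hasMajorant_pair (blk : X → g.Site) {T T' : Module.End ℝ (X → ℝ)} (θ δ : ℝ) (hθ : 0 ≤ θ)
    (hdsymm : ∀ y y' : g.Site, g.dist y y' = g.dist y' y)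
    (hT : HasMajorant blk T (fun a b => θ * Real.exp (-(δ * g.dist a b))))
    (hT' : HasMajorant blk T' (fun a b => θ * Real.exp (-(δ * g.dist a b))))
    (htr : ∀ x x', T' (Pi.single x 1) x' = T (Pi.single x' 1) x) :
    HasL2Majorant blk T (fun a b => θ * Real.exp (-(δ * g.dist a b))) := by
  have hK : ∀ y y' : g.Site, 0 ≤ θ * Real.exp (-(δ * g.dist y y')) := fun y y' => mul_nonneg hθ (Real.exp_nonneg _)
  exact hasL2Majorant_of_hasMajorant_pair_le blk hT hT' hK hK htr (fun _ _ => le_rfl) (fun _ _ => le_rfl)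
    (fun y y' => by rw [hdsymm y y'])

omit [DecidableEq g.Site] [DecidableEq X] in
/-- Cauchy–Schwarz for the `ℓ²` sizes: `Σ_x u(x)w(x) ≤ ‖u‖‖w‖`. [cite: Balaban1984PropagatorsII, (2.140) p.247 (bookkeeping, ours)] -/
theorem sum_mul_le_l2n_mul_l2n (u w : X → ℝ) : ∑ x, u x * w x ≤ l2n u * l2n w := by
  have hcs := Finset.sum_mul_sq_le_sq_mul_sq (Finset.univ : Finset X) u w
  have h1 : ∑ x, u x * w x ≤ Real.sqrt ((∑ x, u x * w x) ^ 2) := by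
    rw [Real.sqrt_sq_eq_abs]; exact le_abs_self _
  refine h1.trans ?_
  calc Real.sqrt ((∑ x, u x * w x) ^ 2) ≤ Real.sqrt ((∑ x, u x ^ 2) * ∑ x, w x ^ 2) := Real.sqrt_le_sqrt hcs
    _ = Real.sqrt (l2n u ^ 2 * l2n w ^ 2) := by rw [l2n_sq, l2n_sq]
    _ = l2n u * l2n w := by
        rw [Real.sqrt_mul (sq_nonneg _), Real.sqrt_sq (l2n_nonneg u), Real.sqrt_sq (l2n_nonneg w)]

/-- **BLOCK-`ℓ²` MAJORANTS PASS TO THE TRANSPOSE** (what the sup shape (2.136) cannot do): if `T` has the block-`ℓ²` majorant `K ≥ 0` and `T′` is its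
transpose-partner (`T′δ_x(x′) = Tδ_{x′}(x)`), then `T′` has the block-`ℓ²` majorant `(y,y′) ↦ K(y′,y)` — `‖Δ(y)T′u‖² = ⟨Δ(y)T′u, T′u⟩ = ⟨T(Δ(y)T′u), u⟩ ≤
‖Δ(y′)T(Δ(y)T′u)‖‖u‖ ≤ K(y′,y)‖Δ(y)T′u‖‖u‖` for `supp u ⊂ Δ(y′)`.  So the `L²` entries `‖ζG∇*J‖`, `‖ζG∇*∇*J‖` of (2.140) are the transposes of `‖ζ∇GJ‖`,
`‖ζ∇∇GJ‖` (`G† = G`). [cite: Balaban1984PropagatorsII, Prop. 2.6 (2.140)–(2.141) p.247; derivation ours (duality)] -/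
theorem hasL2Majorant_transpose (blk : X → g.Site) {T T' : Module.End ℝ (X → ℝ)} {K : g.Site → g.Site → ℝ}
    (hT : HasL2Majorant blk T K) (hK : ∀ y y', 0 ≤ K y y') (htr : ∀ x x', T' (Pi.single x 1) x' = T (Pi.single x' 1) x) :
    HasL2Majorant blk T' (fun y y' => K y' y) := by
  intro y y' u hu
  set v : X → ℝ := blockPiece blk y (T' u) with hv
  have hvoff : ∀ x, blk x ≠ y → v x = 0 := fun x hx => by simp [hv, blockPiece, hx]
  -- ‖v‖² = Σ_x v(x)(T′u)(x)
  have hv2 : l2n v ^ 2 = ∑ x, v x * T' u x := by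
    rw [l2n_sq]
    refine Finset.sum_congr rfl fun x _ => ?_
    by_cases hx : blk x = y
    · simp [hv, blockPiece, hx, sq]
    · simp [hv, blockPiece, hx]
  -- Σ_x v(x)(T′u)(x) = Σ_{x′} u(x′)(Tv)(x′)  (transpose)
  have key : ∑ x, v x * T' u x = ∑ x', u x' * T v x' := by
    have h1 : ∀ x, v x * T' u x = ∑ x', v x * (u x' * T' (Pi.single x' 1) x) := fun x => by
      rw [apply_eq_sum_single T' u x, Finset.mul_sum]
    have h2 : ∀ x', u x' * T v x' = ∑ x, u x' * (v x * T (Pi.single x 1) x') := fun x' => by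
      rw [apply_eq_sum_single T v x', Finset.mul_sum]
    simp_rw [h1, h2]
    rw [Finset.sum_comm]
    refine Finset.sum_congr rfl fun x' _ => Finset.sum_congr rfl fun x _ => ?_
    rw [htr x' x]; ring
  -- Σ_{x′} u(x′)(Tv)(x′) = Σ_{x′} u(x′)(Δ(y′)Tv)(x′) ≤ ‖u‖·‖Δ(y′)Tv‖ ≤ ‖u‖·K(y′,y)‖v‖
  have hcut : ∑ x', u x' * T v x' = ∑ x', u x' * blockPiece blk y' (T v) x' := by
    refine Finset.sum_congr rfl fun x' _ => ?_
    by_cases hx' : blk x' = y'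
    · simp [blockPiece, hx']
    · rw [hu x' hx']; simp
  have hbound : l2n v ^ 2 ≤ l2n u * (K y' y * l2n v) := by
    rw [hv2, key, hcut]
    exact (sum_mul_le_l2n_mul_l2n _ _).trans (mul_le_mul_of_nonneg_left (hT y' y v hvoff) (l2n_nonneg u))
  -- divide by ‖v‖ (or v = 0)
  by_cases h0 : l2n v = 0
  · rw [h0]; exact mul_nonneg (hK y' y) (l2n_nonneg u)
  · have hpos : 0 < l2n v := lt_of_le_of_ne (l2n_nonneg v) (Ne.symm h0)
    have : l2n v * l2n v ≤ (K y' y * l2n u) * l2n v := by nlinarith [hbound]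
    exact le_of_mul_le_mul_right this hpos

/-- **THE TRANSPOSE `tr T` INHERITS THE BLOCK-`ℓ²` MAJORANT WITH SWAPPED ARGUMENTS** (p38's `B6OpTransposeV1.tr`; the kernel relation `htr` is its
`tr_apply_single`): (2.140)₆ = (2.140)₅ᵀ and (2.140)₃ = (2.140)₂ᵀ read on the operator transpose. [cite: Balaban1984PropagatorsII, (2.140)–(2.141) p.247; derivation ours] -/
theorem hasL2Majorant_tr (blk : X → g.Site) {T : Module.End ℝ (X → ℝ)} {K : g.Site → g.Site → ℝ}
    (hT : HasL2Majorant blk T K) (hK : ∀ y y', 0 ≤ K y y') : HasL2Majorant blk (B6OpTransposeV1.tr T) (fun y y' => K y' y) :=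
  hasL2Majorant_transpose blk hT hK fun x x' => by
    rw [B6OpTransposeV1.tr_apply_single]
    simp [dotProduct, Pi.single_apply]

end Literature.MathematicalPhysics.QuantumFieldTheory.Balaban1983to89.B6RandomWalkL2Schur
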